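import Mathlib
import Summits.NavierStokesRegularity.NavierStokesRegularity.Theorems.WakeRatchetAdmissibleEternalBoundCriticalVisc
import Summits.NavierStokesRegularity.NavierStokesRegularity.Theses.WakeRatchet
import HarnessLib
import HarnessLib.Audit

/-!
# `WakeRatchet.AdmissibleEternalBound` (stmt-NavierStokesRegularity-23197) — negative lemma modulo
# GLOBAL SELF-SIMILAR PROFILES: a two-sided discretely self-similar solution of the (viscous or
# inviscid) lattice, re-centred one unit of time after its focusing time, is admissible but NOT
# uniformly bounded

MODEL lattice ODEs only (Tao 2016 §4, §6.4); nothing in this file is a statement about the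
Navier–Stokes equations, and nothing is settled unconditionally.

THE MECHANISM (companion files `WakeRatchetAdmissibleEternalBoundCritical`, `…CriticalVisc`).  In the
critical variables `V_n(t) = e^{σ} W_n(σ)`, `t = t⋆ - e^{-σ}`, an admissible eternal solution with
covariant viscosity `ν̂ ≥ 0` is a shell-wise solution of the AUTONOMOUS lattice
`V̇_n = Q(V_n) + Λ A(V_{n-1}) + Λ⁻¹ B(V_{n+1},V_n) - ν̂ λ^{2n} V_n` (`λ = 1+ε₀`, `Λ = λ^{5/2}`; this is
Tao's cascade in the amplitude-rescaled variables `V_n = Λ^n X_n`) on `t < t⋆` with uniformly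
integrable shells, and `UniformBound W` reads `‖V_n(t)‖ ≤ C/(t⋆ - t)`.  The centre `t⋆` is invisible
in these variables (`isEternalVisc_recentre`).  The lattice has the discrete scaling symmetry
`V_n(t) ↦ κ V_{n-1}(κ t)` exactly when `ν̂ = 0` (any `κ > 0`) or `κ = λ²` (any `ν̂`), so it carries
DISCRETELY SELF-SIMILAR solutions `V_n(t) = κ^n U(κ^n t)` whenever the profile `U : ℝ → ℝ^m` solves
the functional-differential equation (advanced in the feed, retarded in the back-reaction)

  `U'(s) = Q(U(s)) + Λ κ⁻² A(U(s/κ)) + Λ⁻¹ κ B(U(κ s), U(s)) - ν̂ U(s)`      (P)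

(`hasDerivAt_selfSimilar`).  A profile on the half-line `s < 0` is a DSS blow-up wave focusing at
`t = 0` (the tree's `IsDSSWave` in critical variables, `κ = e^{T}`); re-centred AT its focusing time
it is uniformly bounded (tree: `IsDSSWave.uniformBound`).  But a GLOBAL profile — (P) on all of `ℝ`
with `∫_ℝ ‖U‖ < ∞`, i.e. a self-similar solution that passes shell-wise smoothly through its own
focusing time (for `ν̂ > 0`, `κ = λ²`: the self-similar blow-up of the viscous lattice continued
self-similarly into the dissipation range; for `ν̂ = 0`: a focusing cascade followed by a
self-similar defocusing) — gives, re-centred at `t⋆ = 1`, an admissible eternal solution of the same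
table with the same `ν̂` whose shells have action `≤ ∫_ℝ‖U‖` (`integrable_selfSimilar`) and whose
renormalised amplitudes `(1 - κ^{-n}s₀) κ^n ‖U(s₀)‖` are unbounded (`not_uniformBound_selfSimilar`).
No symmetry of the table and no condition on the terminal profile is involved (contrast the
negative lemma modulo `SymmetricBounceWaves`).

* `exists_not_uniformBound_of_globalProfile` — the construction, for any table and any `m`.
* `GlobalSelfSimilarProfiles` (the construction item, `@[conjecture]`): at some spread `R ≥ 1` and at
  arbitrarily small scale ratios, some table of E₂(R) carries a non-zero global integrable solution of
  (P) (`ν̂ = 0` with any `κ > 1`, or `ν̂ ≥ 0` with `κ = (1+ε₀)²`).  STATUS IN PRINT: self-similar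
  blow-up profiles of shell models are known numerically only (Dombre–Gilson renormalisation,
  nonlinear eigenvalue problem; e.g. arXiv:2501.07377 for Sabra) — no existence theorem, let alone
  a two-sided one; explicit (exponential / rational / piecewise-analytic) profiles are impossible
  (crux notes PROVER-g5-analysis.md; exponentials force `κ = 2 > Λ`).
* `AdmissibleEternalBound_false_of_GlobalSelfSimilarProfiles : GlobalSelfSimilarProfiles → ¬ AdmissibleEternalBound`.

HONEST FRAMING: a conditional refutation.  It shows that the crux, as filed, forbids every table of
the class from carrying a self-similar blow-up with a self-similar (or any admissible) continuation —
the generic expected phenomenology of these lattices — whereas its parent K2ᵛ (stmt-20420) only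
consumes admissible solutions that SURVIVE FORWARD at the centre (`EternalSurvivingFwd 1`), which the
re-centred solutions of this file do not.
-/

noncomputable section

set_option linter.dupNamespace false

namespace Summit.NavierStokesRegularity.NavierStokesRegularity.Theorems

namespace WakeRatchetSelfSimilar

open Filter Topology MeasureTheory Set
open scoped RealInnerProductSpace
open Literature.Analysis.FluidPDE Literature.Analysis.FluidPDE.TaoCascade
open WakeRatchetCritical WakeRatchetCriticalVisc

variable {m : ℕ}

section SelfSimilar

variable {ε₀ νh κ : ℝ} {α : Fin m → Fin m → Fin m → ℤ × ℤ × ℤ → ℝ} {U : ℝ → Em m}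

/-- **Self-similar solutions of the autonomous lattice.**  If the profile `U` solves the functional
equation (P) `U'(s) = Q(U(s)) + Λκ⁻² A(U(s/κ)) + Λ⁻¹κ B(U(κs), U(s)) - ν̂ U(s)` on `ℝ`, and the viscosity
is compatible with the scaling (`ν̂ λ^{2n} = ν̂ κ^n` for all `n`, i.e. `ν̂ = 0` or `κ = λ²`), then
`V_n(t) := κ^n U(κ^n t)` solves the autonomous viscous lattice
`V̇_n = Q(V_n) + Λ A(V_{n-1}) + Λ⁻¹ B(V_{n+1}, V_n) - ν̂ λ^{2n} V_n` at every `t ∈ ℝ` (`λ = 1+ε₀`).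
[cite: Tao2016AveragedNS, §4 Lemma 4.1 (4.8), the viscous equation before Thm. 4.2, §6.4 (self-similar variables); cell vocabulary (discretely self-similar ansatz)] -/
theorem hasDerivAt_selfSimilar (hκ : 0 < κ)
    (hvisc : ∀ n : ℤ, νh * (1 + ε₀) ^ ((2 : ℝ) * n) = νh * κ ^ n)
    (hprof : ∀ s : ℝ, HasDerivAt U
      (tableQ α (U s) + (bigLam ε₀ * (κ ^ 2)⁻¹) • tableA α (U (s / κ))
        + ((bigLam ε₀)⁻¹ * κ) • tableB α (U (κ * s)) (U s) - νh • U s) s)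
    (n : ℤ) (t : ℝ) :
    HasDerivAt (fun t : ℝ => κ ^ n • U (κ ^ n * t))
      (tableQ α (κ ^ n • U (κ ^ n * t))
        + bigLam ε₀ • tableA α (κ ^ (n - 1) • U (κ ^ (n - 1) * t))
        + (bigLam ε₀)⁻¹ • tableB α (κ ^ (n + 1) • U (κ ^ (n + 1) * t)) (κ ^ n • U (κ ^ n * t))
        - (νh * (1 + ε₀) ^ ((2 : ℝ) * n)) • (κ ^ n • U (κ ^ n * t))) t := by
  have hκ0 : κ ≠ 0 := hκ.ne'
  have hlin : HasDerivAt (fun s : ℝ => κ ^ n * s) (κ ^ n) t := by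
    simpa using (hasDerivAt_id t).const_mul (κ ^ n)
  have hcomp := (hprof (κ ^ n * t)).scomp t hlin
  have hder := hcomp.const_smul (κ ^ n)
  refine hder.congr_deriv ?_
  have harg1 : κ ^ (n - 1) * t = κ ^ n * t / κ := by rw [zpow_sub_one₀ hκ0]; ring
  have harg2 : κ ^ (n + 1) * t = κ * (κ ^ n * t) := by rw [zpow_add_one₀ hκ0]; ring
  rw [harg1, harg2, zpow_sub_one₀ hκ0, zpow_add_one₀ hκ0, hvisc n]
  simp only [tableQ_smul, tableA_smul, tableB_smul_smul, smul_add, smul_sub, smul_smul]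
  module

/-- **Action of a self-similar shell.**  If `∫_ℝ ‖U‖ < ∞` then every shell `V_n(t) = κ^n U(κ^n t)`
(`κ > 0`) is integrable, with `∫_{t<1} ‖V_n‖ ≤ ∫_ℝ ‖V_n‖ = ∫_ℝ ‖U‖` (the Jacobian of `s = κ^n t`
cancels the amplitude exactly: the action is scale-invariant).
[folklore (change of variables); cell vocabulary (action of `IsEternalVisc`)] -/
theorem integrable_selfSimilar (hκ : 0 < κ) (hint : Integrable (fun s => ‖U s‖)) (n : ℤ) :
    IntegrableOn (fun t : ℝ => ‖κ ^ n • U (κ ^ n * t)‖) (Iio 1) ∧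
      ∫ t in Iio 1, ‖κ ^ n • U (κ ^ n * t)‖ ≤ ∫ s, ‖U s‖ := by
  have hc : 0 < κ ^ n := zpow_pos hκ n
  have hpt : (fun t : ℝ => ‖κ ^ n • U (κ ^ n * t)‖) = fun t => κ ^ n * ‖U (κ ^ n * t)‖ := by
    funext t
    rw [norm_smul, Real.norm_eq_abs, abs_of_pos hc]
  have h1 : Integrable (fun t : ℝ => ‖U (κ ^ n * t)‖) := hint.comp_mul_left' hc.ne'
  have hI : Integrable (fun t : ℝ => ‖κ ^ n • U (κ ^ n * t)‖) := by
    rw [hpt]; exact h1.const_mul (κ ^ n)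
  refine ⟨hI.integrableOn, ?_⟩
  calc ∫ t in Iio 1, ‖κ ^ n • U (κ ^ n * t)‖ ≤ ∫ t, ‖κ ^ n • U (κ ^ n * t)‖ :=
        setIntegral_le_integral hI (Eventually.of_forall fun t => norm_nonneg _)
    _ = ∫ s, ‖U s‖ := by
        rw [hpt, integral_const_mul, Measure.integral_comp_mul_left (fun s => ‖U s‖) (κ ^ n),
          smul_eq_mul, abs_of_pos (inv_pos.2 hc), ← mul_assoc, mul_inv_cancel₀ hc.ne', one_mul]

/-- **A non-zero self-similar family, re-centred after its focusing time, is not uniformly bounded**: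
with `κ > 1` and `U(s₀) ≠ 0`, the renormalised amplitude of shell `n` at the log-time `σ` where
`1 - e^{-σ} = κ^{-n} s₀` equals `(1 - κ^{-n} s₀) κ^n ‖U(s₀)‖ → ∞`.
[cite: Tao2016AveragedNS, §6.4 (self-similar variables); cell vocabulary (`UniformBound`)] -/
theorem not_uniformBound_selfSimilar (hκ : 1 < κ) {s₀ : ℝ} (hs₀ : U s₀ ≠ 0) :
    ¬ UniformBound
      (fun (n : ℤ) (σ : ℝ) => Real.exp (-σ) • (κ ^ n • U (κ ^ n * (1 - Real.exp (-σ))))) := by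
  rintro ⟨C, hC⟩
  have hU : 0 < ‖U s₀‖ := norm_pos_iff.2 hs₀
  obtain ⟨N, hN⟩ := pow_unbounded_of_one_lt (max (2 * |s₀|) (2 * (|C| + 1) / ‖U s₀‖)) hκ
  have hκ0 : (0 : ℝ) < κ := lt_trans zero_lt_one hκ
  have hc : (0 : ℝ) < κ ^ N := pow_pos hκ0 N
  have hN1 : 2 * |s₀| < κ ^ N := lt_of_le_of_lt (le_max_left _ _) hN
  have hN2 : 2 * (|C| + 1) / ‖U s₀‖ < κ ^ N := lt_of_le_of_lt (le_max_right _ _) hN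
  -- the time `t = κ^{-N} s₀ ∈ [-1/2, 1/2]` and the log-time `σ = -log(1 - t)`
  set t : ℝ := s₀ / κ ^ N with ht
  have hct : κ ^ N * t = s₀ := by rw [ht]; field_simp
  have htabs : |t| ≤ 1 / 2 := by
    rw [ht, abs_div, abs_of_pos hc, div_le_iff₀ hc]
    linarith
  have ht_le : t ≤ 1 / 2 := (le_abs_self t).trans htabs
  have hpos : 0 < 1 - t := by linarith
  set σ : ℝ := -Real.log (1 - t) with hσ
  have hexp : Real.exp (-σ) = 1 - t := by rw [hσ, neg_neg, Real.exp_log hpos]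
  have hCN := hC (N : ℤ) σ
  dsimp only at hCN
  rw [zpow_natCast, hexp, sub_sub_cancel, hct, norm_smul, norm_smul, Real.norm_eq_abs,
    Real.norm_eq_abs, abs_of_pos hpos, abs_of_pos hc] at hCN
  -- `(1 - t) κ^N ‖U s₀‖ ≥ κ^N ‖U s₀‖ / 2 > |C| + 1`
  have h2 : 2 * (|C| + 1) < κ ^ N * ‖U s₀‖ := by
    have := (div_lt_iff₀ hU).1 hN2
    linarith
  have h3 : (1 - t) * (κ ^ N * ‖U s₀‖) ≥ (1 / 2) * (κ ^ N * ‖U s₀‖) := by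
    have h0 : 0 ≤ κ ^ N * ‖U s₀‖ := by positivity
    nlinarith
  have h4 : C ≤ |C| := le_abs_self C
  linarith

/-- **The construction.**  Let `U : ℝ → ℝ^m` be a GLOBAL integrable solution of the profile equation
(P) with `κ > 1`, `ν̂ ≥ 0` and `ν̂ = 0 ∨ κ = (1+ε₀)²` (`ε₀ > -1`), not identically zero.  Then the
self-similar family `V_n(t) = κ^n U(κ^n t)`, re-centred at `t⋆ = 1`
(`W_n(σ) = e^{-σ} V_n(1 - e^{-σ})`), is an admissible eternal solution of the table `α` with covariant
viscosity `ν̂` (`IsEternalVisc ε₀ ν̂ α W`) that is NOT uniformly bounded.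
[cite: Tao2016AveragedNS, §4 Lemma 4.1 (4.8), the viscous equation before Thm. 4.2, §6.4; cell vocabulary (`IsEternalVisc`, `UniformBound`)] -/
theorem exists_not_uniformBound_of_globalProfile (hε : -1 < ε₀) (hν : 0 ≤ νh) (hκ : 1 < κ)
    (hvisc : νh = 0 ∨ κ = (1 + ε₀) ^ 2)
    (hprof : ∀ s : ℝ, HasDerivAt U
      (tableQ α (U s) + (bigLam ε₀ * (κ ^ 2)⁻¹) • tableA α (U (s / κ))
        + ((bigLam ε₀)⁻¹ * κ) • tableB α (U (κ * s)) (U s) - νh • U s) s)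
    (hint : Integrable (fun s => ‖U s‖)) {s₀ : ℝ} (hs₀ : U s₀ ≠ 0) :
    ∃ W : ℤ → ℝ → Em m, IsEternalVisc ε₀ νh α W ∧ ¬ UniformBound W := by
  have hκ0 : (0 : ℝ) < κ := lt_trans zero_lt_one hκ
  -- compatibility of the viscosity with the scaling
  have hvisc' : ∀ n : ℤ, νh * (1 + ε₀) ^ ((2 : ℝ) * n) = νh * κ ^ n := by
    intro n
    rcases hvisc with h0 | hk
    · rw [h0, zero_mul, zero_mul]
    · have hb : (0 : ℝ) ≤ 1 + ε₀ := by linarith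
      rw [Real.rpow_mul hb, Real.rpow_two, Real.rpow_intCast, hk]
  -- the self-similar family in critical variables
  set V : ℤ → ℝ → Em m := fun n t => κ ^ n • U (κ ^ n * t) with hV
  have hVder : ∀ (n : ℤ) (t : ℝ), t < 1 → HasDerivAt (V n)
      (tableQ α (V n t) + bigLam ε₀ • tableA α (V (n - 1) t)
        + (bigLam ε₀)⁻¹ • tableB α (V (n + 1) t) (V n t)
        - (νh * (1 + ε₀) ^ ((2 : ℝ) * n)) • V n t) t :=
    fun n t _ => hasDerivAt_selfSimilar hκ0 hvisc' hprof n t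
  have hVint : ∀ n : ℤ, IntegrableOn (fun t => ‖V n t‖) (Iio 1) ∧
      ∫ t in Iio 1, ‖V n t‖ ≤ ∫ s, ‖U s‖ :=
    fun n => integrable_selfSimilar hκ0 hint n
  have hVcont : ∀ n : ℤ, Continuous (V n) := fun n =>
    continuous_iff_continuousAt.2 fun t =>
      (hasDerivAt_selfSimilar (α := α) hκ0 hvisc' hprof n t).continuousAt
  have hVbd : ∀ n : ℤ, ∃ P : ℝ, ∀ t : ℝ, 1 / 2 ≤ t → t < 1 → ‖V n t‖ ≤ P := by
    intro n
    obtain ⟨P, hP⟩ := isCompact_Icc.exists_bound_of_continuousOn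
      ((hVcont n).continuousOn (s := Icc (1 / 2 : ℝ) 1))
    exact ⟨P, fun t h1 h2 => hP t ⟨h1, h2.le⟩⟩
  refine ⟨fun n σ => Real.exp (-σ) • V n (1 - Real.exp (-σ)),
    isEternalVisc_recentre hν hVder hVint hVbd, ?_⟩
  exact not_uniformBound_selfSimilar hκ hs₀

end SelfSimilar

/-! ## The construction item and the negative lemma -/

/-- **The construction `AdmissibleEternalBound` is refuted modulo: GLOBAL SELF-SIMILAR PROFILES at
arbitrarily small scale ratios.**  At some spread `R ≥ 1`, for every `ε > 0` there are
`ε₀ ∈ (0, ε]`, a table `α ∈ E₂(R)`, a covariant viscosity `ν̂ ≥ 0` and a ratio `κ > 1` compatible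
with the scaling of the lattice (`ν̂ = 0`, or `κ = (1+ε₀)²`), and a GLOBAL profile `U : ℝ → ℝ⁴` —
a solution on all of `ℝ` of
`U'(s) = Q(U(s)) + Λκ⁻² A(U(s/κ)) + Λ⁻¹κ B(U(κ s), U(s)) - ν̂ U(s)`, `Λ = (1+ε₀)^{5/2}` —
with `∫_ℝ ‖U‖ < ∞` and `U ≢ 0`.  Equivalently: the (viscous, `κ = λ²`; or inviscid) lattice of
some comparable table has a discretely self-similar solution `Λ^n X_n(t) = κ^n U(κ^n (t - t⋆))`
defined shell-wise THROUGH its focusing time `t⋆`, with scale-invariant finite action.  In print such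
profiles (even one-sided ones) are numerical only (Dombre–Gilson renormalisation / nonlinear
eigenvalue problem, e.g. arXiv:2501.07377); explicit profiles do not exist (exponential ansätze
force `κ = 2 > Λ`).
[cite: Tao2016AveragedNS, §4 Lemma 4.1 (4.8), the viscous equation before Thm. 4.2, §6.4; cell vocabulary (construction item for stmt-23197)] -/
@[conjecture] def GlobalSelfSimilarProfiles : Prop :=
  ∃ R : ℝ, 1 ≤ R ∧ ∀ εs : ℝ, 0 < εs → ∃ ε₀ : ℝ, 0 < ε₀ ∧ ε₀ ≤ εs ∧
    ∃ α : Fin 4 → Fin 4 → Fin 4 → ℤ × ℤ × ℤ → ℝ, InTableClass R α ∧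
    ∃ νh κ : ℝ, 0 ≤ νh ∧ 1 < κ ∧ (νh = 0 ∨ κ = (1 + ε₀) ^ 2) ∧
    ∃ U : ℝ → Em 4,
      (∀ s : ℝ, HasDerivAt U
        (tableQ α (U s) + (bigLam ε₀ * (κ ^ 2)⁻¹) • tableA α (U (s / κ))
          + ((bigLam ε₀)⁻¹ * κ) • tableB α (U (κ * s)) (U s) - νh • U s) s) ∧
      Integrable (fun s => ‖U s‖) ∧ ∃ s₀ : ℝ, U s₀ ≠ 0

/-- **Negative lemma: `GlobalSelfSimilarProfiles → ¬ AdmissibleEternalBound`.**  The re-centred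
self-similar family of a global profile is an admissible eternal solution (same `ν̂`) of a comparable
table, at an arbitrarily small scale ratio, that is not uniformly bounded — contradicting the crux
below its threshold.
[cite: Tao2016AveragedNS, §4, §6.4; cell vocabulary (stmt-NavierStokesRegularity-23197)] -/
theorem AdmissibleEternalBound_false_of_GlobalSelfSimilarProfiles :
    GlobalSelfSimilarProfiles →
      ¬ Summit.NavierStokesRegularity.NavierStokesRegularity.Theses.WakeRatchet.AdmissibleEternalBound := by
  rintro ⟨R, hR, H⟩ hS
  obtain ⟨εs, hεs, HS⟩ := hS R hR
  obtain ⟨ε₀, hε₀, hle, α, hα, νh, κ, hν, hκ, hvisc, U, hprof, hint, s₀, hs₀⟩ := H εs hεs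
  obtain ⟨W, hW, hnot⟩ := exists_not_uniformBound_of_globalProfile (by linarith) hν hκ hvisc
    hprof hint hs₀
  exact hnot (HS ε₀ hε₀ hle α hα νh W hW)

/-! ## The re-centred self-similar family does not survive forward

Support for the restatement question (crux notes `Cruxes/AdmissibleEternalBound/PROVER-g6-analysis.md` §3):
the witnesses of this file are invisible to the parent's clause `EternalSurvivingFwd 1`
(`EternalRigidityViscBdd R 1` asks for `IsEternalVisc ∧ UniformBound ∧ EternalSurvivingFwd 1`). -/

section NotSurviving

variable {ε₀ κ : ℝ} {U : ℝ → Em m}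

/-- **The re-centred self-similar family is not forward-surviving at any exponent `a < 5`**, as soon
as the profile has `s‖U(s)‖` bounded on `[1, ∞)`: at the new centre `t⋆ = 1` nothing focuses, and
the `a`-weighted renormalised energy of shell `n` at log-times `σ ≥ 1` (`t = 1 - e^{-σ} ∈ [1/2, 1)`,
`κ^n t ≥ 1`) is `physWeight(a)^n (κ^n ‖U(κ^n t)‖)² ≤ 4D² physWeight(a)^n → 0` (`physWeight(a) =
λ^{a-5} < 1`).  So the witnesses of `exists_not_uniformBound_of_globalProfile` refute `UniformBound`
but never the parent's conjunction `UniformBound ∧ EternalSurvivingFwd 1`: the statement «admissible ∧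
forward-surviving at exponent 1 ⇒ uniformly bounded» is immune to them.
[cite: Tao2016AveragedNS, §4 (the viscous equation before Thm. 4.2; the scale weight `physWeight`), §6.4; cell vocabulary (`EternalSurvivingFwd`)] -/
theorem not_eternalSurvivingFwd_selfSimilar {a D : ℝ} (hε : 0 < ε₀) (ha : a < 5) (hκ : 1 < κ)
    (hD : ∀ s : ℝ, 1 ≤ s → s * ‖U s‖ ≤ D) :
    ¬ EternalSurvivingFwd a ε₀
      (fun (n : ℤ) (σ : ℝ) => Real.exp (-σ) • (κ ^ n • U (κ ^ n * (1 - Real.exp (-σ))))) := by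
  rintro ⟨c, hc, H⟩
  have hκ0 : (0 : ℝ) < κ := lt_trans zero_lt_one hκ
  -- the weight `physWeight a ε₀ = λ^{a-5}` lies in `[0, 1)`
  have hw0 : 0 ≤ physWeight a ε₀ := physWeight_nonneg hε.le
  have hw1 : physWeight a ε₀ < 1 := by
    unfold physWeight
    have hb : (1 : ℝ) < 1 + ε₀ := by linarith
    have h5 : (1 + ε₀) ^ a < (1 + ε₀) ^ ((5 : ℕ) : ℝ) :=
      Real.rpow_lt_rpow_of_exponent_lt hb (by norm_num; exact ha)
    rw [Real.rpow_natCast] at h5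
    exact (div_lt_one (by positivity)).2 h5
  -- `N₁`: `κ^n ≥ 2`; `N₂`: `physWeight^n (4D² + 1) < c`
  obtain ⟨N₁, hN₁⟩ := pow_unbounded_of_one_lt (2 : ℝ) hκ
  have h4D : (0 : ℝ) < 4 * D ^ 2 + 1 := by positivity
  obtain ⟨N₂, hN₂⟩ := exists_pow_lt_of_lt_one (div_pos hc h4D) hw1
  obtain ⟨n, hn, σ, hσ, hle⟩ := H (max (max N₁ N₂) 1)
  have hn1 : N₁ ≤ n := le_trans (le_trans (le_max_left _ _) (le_max_left _ _)) hn
  have hn2 : N₂ ≤ n := le_trans (le_trans (le_max_right _ _) (le_max_left _ _)) hn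
  have hσ1 : (1 : ℝ) ≤ σ := by
    have h1 : (1 : ℝ) ≤ ((max (max N₁ N₂) 1 : ℕ) : ℝ) := by exact_mod_cast le_max_right _ _
    linarith
  -- the time `t = 1 - e^{-σ} ∈ [1/2, 1)`
  set t : ℝ := 1 - Real.exp (-σ) with ht
  have hexp_le : Real.exp (-σ) ≤ 1 / 2 := by
    have h1 : Real.exp (-σ) ≤ Real.exp (-1) := Real.exp_le_exp.2 (by linarith)
    have h2 := Real.exp_neg_one_lt_d9
    norm_num at h2
    linarith
  have ht_ge : 1 / 2 ≤ t := by rw [ht]; linarith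
  -- `κ^n ≥ 2`, so `s = κ^n t ≥ 1` and `κ^n ‖U(s)‖ ≤ D/t ≤ 2D`
  have hκn : (2 : ℝ) ≤ κ ^ n := le_trans hN₁.le (pow_le_pow_right₀ hκ.le hn1)
  have hκn_pos : (0 : ℝ) < κ ^ n := pow_pos hκ0 n
  have hs1 : (1 : ℝ) ≤ κ ^ n * t := by nlinarith
  have hU0 : 0 ≤ ‖U (κ ^ n * t)‖ := norm_nonneg _
  have hamp : κ ^ n * ‖U (κ ^ n * t)‖ ≤ 2 * D := by
    have h1 := hD (κ ^ n * t) hs1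
    nlinarith [mul_nonneg (mul_nonneg hκn_pos.le hU0) (by linarith : (0 : ℝ) ≤ 2 * t - 1)]
  have hsq : (κ ^ n * ‖U (κ ^ n * t)‖) ^ 2 ≤ 4 * D ^ 2 := by
    have h0 : 0 ≤ κ ^ n * ‖U (κ ^ n * t)‖ := by positivity
    nlinarith
  -- the renormalised energy at `(n, σ)` is `(κ^n ‖U(κ^n t)‖)²`
  have hval : Real.exp (2 * σ)
        * ‖Real.exp (-σ) • (κ ^ (n : ℤ) • U (κ ^ (n : ℤ) * (1 - Real.exp (-σ))))‖ ^ 2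
      = (κ ^ n * ‖U (κ ^ n * t)‖) ^ 2 := by
    rw [zpow_natCast, norm_smul, norm_smul, Real.norm_eq_abs, Real.norm_eq_abs,
      abs_of_pos (Real.exp_pos _), abs_of_pos hκn_pos, mul_pow, mul_pow, ← mul_assoc,
      ← Real.exp_nat_mul, ← Real.exp_add]
    have h0 : (2 : ℝ) * σ + ((2 : ℕ) : ℝ) * -σ = 0 := by push_cast; ring
    rw [h0, Real.exp_zero, one_mul]
  dsimp only at hle
  rw [hval] at hle
  -- `c ≤ physWeight^n (2D)² ≤ physWeight^{N₂} 4D² < c`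
  have hpw : physWeight a ε₀ ^ n ≤ physWeight a ε₀ ^ N₂ := pow_le_pow_of_le_one hw0 hw1.le hn2
  have hle' : c ≤ physWeight a ε₀ ^ N₂ * (4 * D ^ 2) :=
    hle.trans (mul_le_mul hpw hsq (by positivity) (pow_nonneg hw0 _))
  have hlt : physWeight a ε₀ ^ N₂ * (4 * D ^ 2) < c := by
    have h4 : (0 : ℝ) ≤ 4 * D ^ 2 := by positivity
    calc physWeight a ε₀ ^ N₂ * (4 * D ^ 2) ≤ c / (4 * D ^ 2 + 1) * (4 * D ^ 2) :=
          mul_le_mul_of_nonneg_right hN₂.le h4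
      _ < c := by
          rw [div_mul_eq_mul_div, div_lt_iff₀ h4D]
          nlinarith
  linarith

end NotSurviving

end WakeRatchetSelfSimilar

end Summit.NavierStokesRegularity.NavierStokesRegularity.Theorems
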